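import Mathlib
import Summits.KontsevichZagierPeriods.Zeta5Search.BrickDenominators
import Summits.KontsevichZagierPeriods.Zeta5Search.BrickBallApery

/-!
# BrickWeightedDenominators — the Krattenthaler–Rivoal exponent for WEIGHTED sums `Σ_k g(k)c_{k,s}(n)`, every
symmetric Lipschitz integer weight `g` (in particular the quadratic moment `Σ_k k(n−k)c_{k,s}(n)`), at every odd prime
(cell zeta5-irr)

HONEST FRAMING: systematic search; no irrationality claim unless certified. INSTRUMENT-tier arithmetic of the ζ(5)
census cell zeta5-irr (HOME `run/shared/lean/pub/zeta5-irr/`), filed by the engine seat zi-eng (g12); sequel of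
`BrickDenominators` (constant weight = Krattenthaler–Rivoal 2007 Théorème 1 at odd primes) and `BrickClassDenominators`
(class-pair indicators); used by `BrickZudilinPartner` (Zudilin's partner coefficients `ũₙ, w̃ₙ, ṽₙ` are such moments).
WHAT THIS IS NOT: no denominator saving beyond print; nothing at `p = 2`; nothing about ζ(5); 0 nats/n; rung F-Z1 NOT moved.

## Statements (`p` an odd prime, `A` even, `1 ≤ B`, `2B ≤ A`; cells `c_{k,s}(n)` of the kernel `R_n^{(A,B,1)}`)

* `level_weight`: zi-p2's H^∞ step (`BrickPropositionHInf.level_step_inf`) for any `g : ℕ → ℤ` with `g(n−k) = g(k)`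
  (`k ≤ n`) and `(k−k') ∣ g(k) − g(k')` — admissibility (I)(S_1)(D) is automatic for such `g`: for every `L`,
  `n < p^{L+1}`: `v(Σ_k g(k)p^{L(A−s)}c_{k,s}(n)) ≤ exp(−L)`, and the harmonic cells likewise.
* **`padicValuation_weightedSum_le`**, `padicValuation_weightedSum_zero_le`:
  `ord_p Σ_{k≤n} g(k)c_{k,s}(n) ≥ −⌊log_p n⌋(A−1−s)`, `ord_p Σ_k g(k)cell^{(0)}_k(n) ≥ −⌊log_p n⌋(A−1)`.
* `padicValuation_quadSum_le`, `padicValuation_quadSum_zero_le`: the instance `g(k) = k(n−k)`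
  (`k(n−k) − k'(n−k') = (k−k')(n−k−k')`). In Krattenthaler–Rivoal's language these are statements about
  `(z∂_z)²p_{l,n}(z)` at `z = 1` (`Σ_K K²c_{l,K} = n·Σ_K Kc_{l,K} − Σ_K K(n−K)c_{l,K}`), not found in print.
-/

namespace Summit.KontsevichZagierPeriods.Zeta5Search.BrickWeightedDenominators

open Finset Nat WithZero Polynomial
open Summit.KontsevichZagierPeriods.Zeta5Search.BrickLaurent (cell)
open Summit.KontsevichZagierPeriods.Zeta5Search.BrickPartialFractions (cellZero xCoeff xZero)
open Summit.KontsevichZagierPeriods.Zeta5Search.BrickTopKummer (cell_one_valuation_abs)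
open Summit.KontsevichZagierPeriods.Zeta5Search.BrickHoleCells (pow_mul_cellZero_valuation)
open Summit.KontsevichZagierPeriods.Zeta5Search.BrickPropositionHInf (level_step_inf propositionH_inf)
open Summit.KontsevichZagierPeriods.Zeta5Search.BrickBallApery (padicValuation_intCast_le_exp_neg_iff)
open Summit.KontsevichZagierPeriods.Zeta5Search.BrickDenominators (le_exp_of_pow_mul_le padicValuation_lcmUpto
  den_eq_two_pow_of_padicValuation_le)

noncomputable section

variable {p : ℕ} [Fact p.Prime]

/-! ## PROPOSITION H^∞ with an integer-valued symmetric Lipschitz weight -/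

section weight

variable (hp2 : p ≠ 2) {A B : ℕ} (hA : Even A) (hB : 1 ≤ B) (hAB : 2 * B ≤ A)
include hp2 hA hB hAB

/-- **H^∞, general symmetric weight** (every odd prime `p`; EVERY level `L`, `n < p^{L+1}`, kernel `ε = 1`): for every
`g : ℕ → ℤ` with `g(n−k) = g(k)` (`k ≤ n`) and `(k − k') ∣ g(k) − g(k')` (e.g. any polynomial in `k(n−k)` with integer
coefficients): `v(Σ_k g(k)·p^{LA}cell^{(0)}_k(n)) ≤ exp(−L)` and `v(Σ_k g(k)·p^{L(A−s)}c_{k,s}(n)) ≤ exp(−L)` for all `s` —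
`BrickPropositionHInf.level_step_inf` once more: such a `g` is (I) integral, (S_1) symmetric, (D) digit-local. -/
theorem level_weight {L n : ℕ} (hn : n < p ^ (L + 1)) {g : ℕ → ℤ} (hgS : ∀ k, k ≤ n → g (n - k) = g k)
    (hgD : ∀ k k' : ℕ, ((k : ℤ) - k') ∣ g k - g k') :
    Rat.padicValuation p (∑ j ∈ range (n + 1), (g j : ℚ) * ((p : ℚ) ^ (L * A) * cellZero A B 1 n j)) ≤
        exp (-(L : ℤ)) ∧
      ∀ s, Rat.padicValuation p (∑ j ∈ range (n + 1), (g j : ℚ) * ((p : ℚ) ^ (L * (A - s)) * cell A B 1 n j s)) ≤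
        exp (-(L : ℤ)) := by
  have hp : p.Prime := Fact.out
  have hgI : ∀ k : ℕ, Rat.padicValuation p (g k : ℚ) ≤ 1 := fun k => by
    rw [Rat.padicValuation_cast]; exact Int.padicValuation_le_one p _
  rcases L with _ | L
  · refine ⟨?_, fun s => ?_⟩
    · rw [Nat.cast_zero, neg_zero, exp_zero, zero_mul]
      refine Valuation.map_sum_le _ fun j hj => ?_
      have hj' : j ≤ n := by have := mem_range.1 hj; omega
      rw [map_mul]
      refine mul_le_one' (hgI j) ((pow_mul_cellZero_valuation hp2 hAB (L := 0) hn hj' 0).trans (exp_le_exp.2 ?_))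
      simp only [Nat.cast_zero, zero_mul, Nat.cast_mul]
      nlinarith [Int.natCast_nonneg A, Int.natCast_nonneg (padicValNat p (n.choose j))]
    · rw [Nat.cast_zero, neg_zero, exp_zero, zero_mul, pow_zero]
      refine Valuation.map_sum_le _ fun j hj => ?_
      have hj' : j ≤ n := by have := mem_range.1 hj; omega
      have h := cell_one_valuation_abs hp2 hAB (L := 0) hn hj' s
      rw [Nat.cast_zero, zero_mul, exp_zero] at h
      rw [map_mul, one_mul]
      exact mul_le_one' (hgI j) h
  · obtain ⟨n₀, N, hn₀, rfl⟩ : ∃ n₀ N, n₀ < p ∧ n = n₀ + N * p :=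
      ⟨n % p, n / p, Nat.mod_lt _ hp.pos, (Nat.mod_add_div' n p).symm⟩
    have hN : N < p ^ (L + 1) := by
      rw [Nat.lt_iff_add_one_le]
      by_contra h
      have h' : p ^ (L + 1) ≤ N := by omega
      have : p ^ (L + 1 + 1) ≤ n₀ + N * p := by
        calc p ^ (L + 1 + 1) = p ^ (L + 1) * p := pow_succ _ _
          _ ≤ N * p := Nat.mul_le_mul_right _ h'
          _ ≤ n₀ + N * p := Nat.le_add_left _ _
      omega
    have h := level_step_inf hp2 hA hB hAB (ε := 1) le_rfl hn₀ hN (g := fun k : ℕ => (g k : ℚ))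
      (fun k _ => hgI k) (fun k hk => ?_) (fun e k k' _ _ _ _ hdvd => ?_)
      (fun M' hM' g' h1 h2 h3 => propositionH_inf hp2 hA hB hAB L M' hM' g' h1 h2 h3)
    · exact_mod_cast h
    · rw [pow_one, neg_one_mul, ← sub_eq_add_neg, ← Int.cast_sub, hgS k hk, sub_self, Int.cast_zero, map_zero]
      exact _root_.zero_le
    · rw [← Int.cast_sub, padicValuation_intCast_le_exp_neg_iff]
      exact ((dvd_neg.2 hdvd).trans (by rw [neg_sub]; exact hgD k' k))

/-- **The Krattenthaler–Rivoal exponent for weighted sums**: for every `g : ℕ → ℤ`, symmetric (`g(n−k) = g(k)`) and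
Lipschitz (`(k−k') ∣ g(k) − g(k')`), every `n`, `s`: `v(Σ_{k≤n} g(k)c_{k,s}(n)) ≤ exp(⌊log_p n⌋·(A−1−s))`, i.e.
`ord_p Σ_k g(k)c_{k,s}(n) ≥ −⌊log_p n⌋(A−1−s)` (odd `p`). -/
theorem padicValuation_weightedSum_le (n s : ℕ) {g : ℕ → ℤ} (hgS : ∀ k, k ≤ n → g (n - k) = g k)
    (hgD : ∀ k k' : ℕ, ((k : ℤ) - k') ∣ g k - g k') :
    Rat.padicValuation p (∑ j ∈ range (n + 1), (g j : ℚ) * cell A B 1 n j s) ≤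
      exp ((Nat.log p n : ℤ) * ((A - 1 - s : ℕ) : ℤ)) := by
  have hp : p.Prime := Fact.out
  have hn : n < p ^ (Nat.log p n + 1) := Nat.lt_pow_succ_log_self hp.one_lt n
  have h := (level_weight hp2 hA hB hAB hn hgS hgD).2 s
  have h' : Rat.padicValuation p ((p : ℚ) ^ (Nat.log p n * (A - s)) *
      ∑ j ∈ range (n + 1), (g j : ℚ) * cell A B 1 n j s) ≤ exp (-(Nat.log p n : ℤ)) := by
    rw [Finset.mul_sum]
    convert h using 3 with j
    ring
  refine (le_exp_of_pow_mul_le h').trans (exp_le_exp.2 ?_)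
  have hτ : (A - s : ℕ) ≤ (A - 1 - s : ℕ) + 1 := by omega
  have hτ' : ((A - s : ℕ) : ℤ) ≤ ((A - 1 - s : ℕ) : ℤ) + 1 := by exact_mod_cast hτ
  push_cast
  nlinarith [Int.natCast_nonneg (Nat.log p n), Int.natCast_nonneg (A - 1 - s)]

/-- The harmonic cells with a symmetric Lipschitz weight: `v(Σ_{k≤n} g(k)cell^{(0)}_k(n)) ≤ exp(⌊log_p n⌋·(A−1))`. -/
theorem padicValuation_weightedSum_zero_le (n : ℕ) {g : ℕ → ℤ} (hgS : ∀ k, k ≤ n → g (n - k) = g k)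
    (hgD : ∀ k k' : ℕ, ((k : ℤ) - k') ∣ g k - g k') :
    Rat.padicValuation p (∑ j ∈ range (n + 1), (g j : ℚ) * cellZero A B 1 n j) ≤
      exp ((Nat.log p n : ℤ) * ((A - 1 : ℕ) : ℤ)) := by
  have hp : p.Prime := Fact.out
  have hn : n < p ^ (Nat.log p n + 1) := Nat.lt_pow_succ_log_self hp.one_lt n
  have h := (level_weight hp2 hA hB hAB hn hgS hgD).1
  have h' : Rat.padicValuation p ((p : ℚ) ^ (Nat.log p n * A) *
      ∑ j ∈ range (n + 1), (g j : ℚ) * cellZero A B 1 n j) ≤ exp (-(Nat.log p n : ℤ)) := by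
    rw [Finset.mul_sum]
    convert h using 3 with j
    ring
  refine (le_exp_of_pow_mul_le h').trans (exp_le_exp.2 ?_)
  have hA1 : 1 ≤ A := by omega
  push_cast [Nat.cast_sub hA1]
  nlinarith [Int.natCast_nonneg (Nat.log p n)]

/-- **The quadratic moment**: `ord_p Σ_{k≤n} k(n−k)·c_{k,s}(n) ≥ −⌊log_p n⌋(A−1−s)` (odd `p`) — the weight `k(n−k)` is
symmetric and Lipschitz (`k(n−k) − k'(n−k') = (k−k')(n−k−k')`). -/
theorem padicValuation_quadSum_le (n s : ℕ) :
    Rat.padicValuation p (∑ j ∈ range (n + 1), ((j : ℚ) * ((n : ℚ) - j)) * cell A B 1 n j s) ≤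
      exp ((Nat.log p n : ℤ) * ((A - 1 - s : ℕ) : ℤ)) := by
  have h := padicValuation_weightedSum_le hp2 hA hB hAB n s (g := fun k : ℕ => (k : ℤ) * ((n : ℤ) - k))
    (fun k hk => by push_cast [Nat.cast_sub hk]; ring) (fun k k' => ⟨(n : ℤ) - k - k', by ring⟩)
  push_cast at h
  exact h

/-- The quadratic moment of the harmonic cells: `ord_p Σ_{k≤n} k(n−k)·cell^{(0)}_k(n) ≥ −⌊log_p n⌋(A−1)` (odd `p`). -/
theorem padicValuation_quadSum_zero_le (n : ℕ) :
    Rat.padicValuation p (∑ j ∈ range (n + 1), ((j : ℚ) * ((n : ℚ) - j)) * cellZero A B 1 n j) ≤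
      exp ((Nat.log p n : ℤ) * ((A - 1 : ℕ) : ℤ)) := by
  have h := padicValuation_weightedSum_zero_le hp2 hA hB hAB n (g := fun k : ℕ => (k : ℤ) * ((n : ℤ) - k))
    (fun k hk => by push_cast [Nat.cast_sub hk]; ring) (fun k k' => ⟨(n : ℤ) - k - k', by ring⟩)
  push_cast at h
  exact h

end weight


end

end Summit.KontsevichZagierPeriods.Zeta5Search.BrickWeightedDenominators
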